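import Summits.MatrixMultiplication.MatrixMultiplication.Theorems.SoloInformedCwTwoCayleyCensus
import HarnessLib

/-!
# The infinitesimal orbit map as a semicontinuous invariant (every characteristic)

Solo programme `solo-MatrixMultiplication-informed`, generation 27 (kernel companion of the
every-field census of the door tensor `T_{cw,2}`; the data and the theorem `cw₂ ⋭ N₅` in
characteristic `2` are in `SoloInformedOrbitRankCensus`).

* `OrbitRank.orbitForm T` — the `27 × 27` matrix of the infinitesimal orbit map
  `gl₃ ⊕ gl₃ ⊕ gl₃ → K³ ⊗ K³ ⊗ K³`, `(X, Y, Z) ↦ X·₁T + Y·₂T + Z·₃T`; column `(f, p, q)` is the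
  elementary matrix `E_{pq}` acting in factor `f` (`orbitForm_apply`).  Its rank is the dimension of
  the tangent space of the orbit — a MATRIX rank, hence meaningful and lower semicontinuous in every
  characteristic (inseparability of orbit maps is irrelevant).
* **Equivariance** (`kronT_mul_orbitForm_mul`): `(A ⊗ B ⊗ C)ᵀ · O_T · Φ = O_{(A,B,C)·T} · D` with
  `Φ = ⊕_f adj(M_fᵀ) ⊗ M_f` and `D = ⊕_f det M_f · 1₉` (block `X` by Kronecker algebra, blocks `Y`,
  `Z` by transporting block `X` along the factor swaps); so invertible substitutions do not increase
  `rank O` (`rank_orbitForm_tsubst3_le`), and by the perturbation argument of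
  `SoloInformedCwTwoCayley` neither do degenerations (`rank_orbitForm_le_of_polyDegeneratesTo`).
Sources: [cite: Alman2021, §2.4]; [cite: ConnerGesmundoLandsbergVentura2022, §3.2].
Everything here is PROVED; no new axioms.
-/

namespace Summit.MatrixMultiplication.MatrixMultiplication.Theorems

open Matrix Polynomial Finset
open Literature.Computability.AlgebraicComplexity Literature.Barriers.MatrixMultiplication
open Literature.LinearAlgebra.Matrix
open scoped Kronecker Polynomial

universe u

namespace OrbitRank

open CayleyOmega

/-! ## The orbit form -/

section Form

variable {R : Type*} [CommRing R]

/-- The first flattening as a `3 × 9` matrix: `(flat T)_{q,(b,c)} = T_{qbc}`. [folklore] -/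
def flat (T : Fin 3 → Fin 3 → Fin 3 → R) : Matrix (Fin 3) (Fin 3 × Fin 3) R :=
  Matrix.of fun q bc => T q bc.1 bc.2

/-- The `X`-block of the orbit map: column `(p, q)` is `E_{pq} ·₁ T`. [folklore] -/
def oblkX (T : Fin 3 → Fin 3 → Fin 3 → R) : Matrix Idx (Fin 3 × Fin 3) R :=
  (1 : Matrix (Fin 3) (Fin 3) R) ⊗ₖ (flat T)ᵀ

/-- Entries of the `X`-block. [folklore] -/
theorem oblkX_apply (T : Fin 3 → Fin 3 → Fin 3 → R) (v : Idx) (pq : Fin 3 × Fin 3) :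
    oblkX T v pq = if v.1 = pq.1 then T pq.2 v.2.1 v.2.2 else 0 := by
  rcases v with ⟨a, b, c⟩
  rcases pq with ⟨p, q⟩
  simp only [oblkX, flat, Matrix.kronecker_apply, Matrix.one_apply, Matrix.transpose_apply,
    Matrix.of_apply, boole_mul]

/-- Swap of the first two tensor factors. [folklore] -/
def swapXY (T : Fin 3 → Fin 3 → Fin 3 → R) : Fin 3 → Fin 3 → Fin 3 → R := fun a b c => T b a c

/-- Swap of the first and third tensor factors. [folklore] -/
def swapXZ (T : Fin 3 → Fin 3 → Fin 3 → R) : Fin 3 → Fin 3 → Fin 3 → R := fun a b c => T c b a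

/-- The index swap `(a,b,c) ↦ (b,a,c)`. [folklore] -/
def σXY : Idx ≃ Idx where
  toFun v := (v.2.1, v.1, v.2.2)
  invFun v := (v.2.1, v.1, v.2.2)
  left_inv _ := rfl
  right_inv _ := rfl

/-- The index swap `(a,b,c) ↦ (c,b,a)`. [folklore] -/
def σXZ : Idx ≃ Idx where
  toFun v := (v.2.2, v.2.1, v.1)
  invFun v := (v.2.2, v.2.1, v.1)
  left_inv _ := rfl
  right_inv _ := rfl

/-- Pointwise form of `σXY`. [folklore] -/
@[simp] theorem σXY_apply (v : Idx) : σXY v = (v.2.1, v.1, v.2.2) := rfl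

/-- Pointwise form of `σXZ`. [folklore] -/
@[simp] theorem σXZ_apply (v : Idx) : σXZ v = (v.2.2, v.2.1, v.1) := rfl

/-- The `Y`-block: column `(p, q)` is `E_{pq} ·₂ T`. [folklore] -/
def oblkY (T : Fin 3 → Fin 3 → Fin 3 → R) : Matrix Idx (Fin 3 × Fin 3) R :=
  (oblkX (swapXY T)).submatrix σXY id

/-- The `Z`-block: column `(p, q)` is `E_{pq} ·₃ T`. [folklore] -/
def oblkZ (T : Fin 3 → Fin 3 → Fin 3 → R) : Matrix Idx (Fin 3 × Fin 3) R :=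
  (oblkX (swapXZ T)).submatrix σXZ id

/-- The three blocks as a family. [folklore] -/
def blk (T : Fin 3 → Fin 3 → Fin 3 → R) : Fin 3 → Matrix Idx (Fin 3 × Fin 3) R :=
  ![oblkX T, oblkY T, oblkZ T]

/-- **The orbit form** `O_T`: rows = basis of `K³ ⊗ K³ ⊗ K³`, columns `(f, p, q)` = `E_{pq}` in
factor `f`. [folklore] -/
def orbitForm (T : Fin 3 → Fin 3 → Fin 3 → R) : Matrix Idx Idx R :=
  fun v w => blk T w.1 v w.2

/-- Block `0`. [folklore] -/
@[simp] theorem blk_zero (T : Fin 3 → Fin 3 → Fin 3 → R) : blk T 0 = oblkX T := rfl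

/-- Block `1`. [folklore] -/
@[simp] theorem blk_one (T : Fin 3 → Fin 3 → Fin 3 → R) : blk T 1 = oblkY T := rfl

/-- Block `2`. [folklore] -/
@[simp] theorem blk_two (T : Fin 3 → Fin 3 → Fin 3 → R) : blk T 2 = oblkZ T := rfl

/-- Explicit entries of `O_T`. [folklore] -/
theorem orbitForm_apply (T : Fin 3 → Fin 3 → Fin 3 → R) (v w : Idx) :
    orbitForm T v w =
      if w.1 = 0 then (if v.1 = w.2.1 then T w.2.2 v.2.1 v.2.2 else 0)
      else if w.1 = 1 then (if v.2.1 = w.2.1 then T v.1 w.2.2 v.2.2 else 0)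
      else (if v.2.2 = w.2.1 then T v.1 v.2.1 w.2.2 else 0) := by
  rcases w with ⟨f, p, q⟩
  fin_cases f <;>
    simp [orbitForm, blk, oblkY, oblkZ, oblkX_apply, swapXY, swapXZ]

/-- `O` is additive in `T`. [folklore] -/
theorem orbitForm_add (T T' : Fin 3 → Fin 3 → Fin 3 → R) :
    orbitForm (T + T') = orbitForm T + orbitForm T' := by
  ext v w
  simp only [orbitForm_apply, Matrix.add_apply, Pi.add_apply]
  split_ifs <;> simp

/-- `O` is homogeneous in `T`. [folklore] -/
theorem orbitForm_smul (c : R) (T : Fin 3 → Fin 3 → Fin 3 → R) :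
    orbitForm (c • T) = c • orbitForm T := by
  ext v w
  simp only [orbitForm_apply, Matrix.smul_apply, Pi.smul_apply, smul_eq_mul]
  split_ifs <;> simp

/-- `O` commutes with ring maps. [folklore] -/
theorem orbitForm_map {S : Type*} [CommRing S] (f : R →+* S) (T : Fin 3 → Fin 3 → Fin 3 → R) :
    (orbitForm T).map f = orbitForm (fun a b c => f (T a b c)) := by
  ext v w
  simp only [orbitForm_apply, Matrix.map_apply]
  split_ifs <;> simp

/-- Integer tensors read in `R`. [folklore] -/
theorem orbitForm_map_intCast (N : Fin 3 → Fin 3 → Fin 3 → ℤ) :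
    (orbitForm N).map (Int.cast : ℤ → R) = orbitForm (fun a b c => (N a b c : R)) := by
  ext v w
  simp only [orbitForm_apply, Matrix.map_apply]
  split_ifs <;> simp

/-- Entrywise form of `orbitForm_map_intCast`. [folklore] -/
theorem orbitForm_intCast (N : Fin 3 → Fin 3 → Fin 3 → ℤ) (v w : Idx) :
    orbitForm (fun a b c => (N a b c : R)) v w = ((orbitForm N v w : ℤ) : R) := by
  rw [← orbitForm_map_intCast, Matrix.map_apply]

end Form

/-! ## Equivariance -/

section Equivariance

variable {R : Type*} [CommRing R]

/-- The flattening of the substituted tensor. [folklore] -/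
theorem flat_tsubst3 (T : Fin 3 → Fin 3 → Fin 3 → R) (A B C : Fin 3 → Fin 3 → R) :
    flat (tsubst3 T A B C) = (Matrix.of A)ᵀ * flat T * (Matrix.of B ⊗ₖ Matrix.of C) := by
  ext q bc
  rcases bc with ⟨b, c⟩
  simp only [flat, tsubst3, Matrix.mul_apply, Matrix.of_apply, Matrix.transpose_apply,
    Matrix.kronecker_apply, Fintype.sum_prod_type, Finset.sum_mul]
  refine Finset.sum_comm.trans (Finset.sum_congr rfl fun y _ => ?_)
  refine Finset.sum_comm.trans (Finset.sum_congr rfl fun z _ => Finset.sum_congr rfl fun x _ => ?_)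
  ring

/-- Substitution commutes with the swap of the first two factors. [folklore] -/
theorem tsubst3_swapXY (T : Fin 3 → Fin 3 → Fin 3 → R) (A B C : Fin 3 → Fin 3 → R) :
    tsubst3 (swapXY T) B A C = swapXY (tsubst3 T A B C) := by
  funext a b c
  simp only [tsubst3, swapXY]
  exact Fintype.sum_equiv σXY _ _ fun v => by simp only [σXY_apply]; ring

/-- Substitution commutes with the swap of the first and third factors. [folklore] -/
theorem tsubst3_swapXZ (T : Fin 3 → Fin 3 → Fin 3 → R) (A B C : Fin 3 → Fin 3 → R) :
    tsubst3 (swapXZ T) C B A = swapXZ (tsubst3 T A B C) := by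
  funext a b c
  simp only [tsubst3, swapXZ]
  exact Fintype.sum_equiv σXZ _ _ fun v => by simp only [σXZ_apply]; ring

/-- The transposed Kronecker cube `(A ⊗ B ⊗ C)ᵀ`. [folklore] -/
def kronT (A B C : Fin 3 → Fin 3 → R) : Matrix Idx Idx R :=
  (Matrix.of A ⊗ₖ (Matrix.of B ⊗ₖ Matrix.of C))ᵀ

/-- The block of `Φ` for a factor matrix `M`: `X ↦ adj(Mᵀ) X M` on coordinates. [folklore] -/
def phiBlk (M : Fin 3 → Fin 3 → R) : Matrix (Fin 3 × Fin 3) (Fin 3 × Fin 3) R :=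
  (Matrix.of M)ᵀ.adjugate ⊗ₖ Matrix.of M

/-- **Block `X` equivariance**: `(A⊗B⊗C)ᵀ · O^X_T · (adj Aᵀ ⊗ A) = det A · O^X_{(A,B,C)·T}`.
[folklore] -/
theorem kronT_mul_oblkX_mul (T : Fin 3 → Fin 3 → Fin 3 → R) (A B C : Fin 3 → Fin 3 → R) :
    kronT A B C * oblkX T * phiBlk A = (Matrix.of A).det • oblkX (tsubst3 T A B C) := by
  rw [kronT, phiBlk, oblkX, oblkX, flat_tsubst3, ← Matrix.kroneckerMap_transpose,
    ← Matrix.mul_kronecker_mul, ← Matrix.mul_kronecker_mul, Matrix.mul_one, Matrix.mul_adjugate,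
    Matrix.det_transpose, Matrix.smul_kronecker, Matrix.transpose_mul, Matrix.transpose_mul,
    Matrix.transpose_transpose, Matrix.mul_assoc]

/-- Permuting factors in the Kronecker cube (`X ↔ Y`). [folklore] -/
theorem kronT_eq_submatrix_swapXY (A B C : Fin 3 → Fin 3 → R) :
    kronT A B C = (kronT B A C).submatrix σXY σXY := by
  ext v u
  rcases v with ⟨a, b, c⟩
  rcases u with ⟨x, y, z⟩
  simp only [kronT, Matrix.transpose_apply, Matrix.submatrix_apply, Matrix.kronecker_apply,
    Matrix.of_apply, σXY_apply]
  ring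

/-- Permuting factors in the Kronecker cube (`X ↔ Z`). [folklore] -/
theorem kronT_eq_submatrix_swapXZ (A B C : Fin 3 → Fin 3 → R) :
    kronT A B C = (kronT C B A).submatrix σXZ σXZ := by
  ext v u
  rcases v with ⟨a, b, c⟩
  rcases u with ⟨x, y, z⟩
  simp only [kronT, Matrix.transpose_apply, Matrix.submatrix_apply, Matrix.kronecker_apply,
    Matrix.of_apply, σXZ_apply]
  ring

/-- **Block `Y` equivariance.** [folklore] -/
theorem kronT_mul_oblkY_mul (T : Fin 3 → Fin 3 → Fin 3 → R) (A B C : Fin 3 → Fin 3 → R) :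
    kronT A B C * oblkY T * phiBlk B = (Matrix.of B).det • oblkY (tsubst3 T A B C) := by
  have h1 : kronT A B C * oblkY T = (kronT B A C * oblkX (swapXY T)).submatrix σXY id := by
    rw [kronT_eq_submatrix_swapXY, oblkY, Matrix.submatrix_mul_equiv]
  have h2 : (kronT B A C * oblkX (swapXY T)).submatrix (σXY : Idx → Idx) id * phiBlk B =
      (kronT B A C * oblkX (swapXY T) * phiBlk B).submatrix σXY id := by
    rw [Matrix.submatrix_mul _ (phiBlk B) _ id _ Function.bijective_id, Matrix.submatrix_id_id]
  rw [h1, h2, kronT_mul_oblkX_mul, tsubst3_swapXY, Matrix.submatrix_smul]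
  rfl

/-- **Block `Z` equivariance.** [folklore] -/
theorem kronT_mul_oblkZ_mul (T : Fin 3 → Fin 3 → Fin 3 → R) (A B C : Fin 3 → Fin 3 → R) :
    kronT A B C * oblkZ T * phiBlk C = (Matrix.of C).det • oblkZ (tsubst3 T A B C) := by
  have h1 : kronT A B C * oblkZ T = (kronT C B A * oblkX (swapXZ T)).submatrix σXZ id := by
    rw [kronT_eq_submatrix_swapXZ, oblkZ, Matrix.submatrix_mul_equiv]
  have h2 : (kronT C B A * oblkX (swapXZ T)).submatrix (σXZ : Idx → Idx) id * phiBlk C =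
      (kronT C B A * oblkX (swapXZ T) * phiBlk C).submatrix σXZ id := by
    rw [Matrix.submatrix_mul _ (phiBlk C) _ id _ Function.bijective_id, Matrix.submatrix_id_id]
  rw [h1, h2, kronT_mul_oblkX_mul, tsubst3_swapXZ, Matrix.submatrix_smul]
  rfl

/-- Blockwise equivariance. [folklore] -/
theorem kronT_mul_blk_mul (T : Fin 3 → Fin 3 → Fin 3 → R) (A B C : Fin 3 → Fin 3 → R)
    (f : Fin 3) :
    kronT A B C * blk T f * ![phiBlk A, phiBlk B, phiBlk C] f =
      (![Matrix.of A, Matrix.of B, Matrix.of C] f).det • blk (tsubst3 T A B C) f := by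
  fin_cases f
  · exact kronT_mul_oblkX_mul T A B C
  · exact kronT_mul_oblkY_mul T A B C
  · exact kronT_mul_oblkZ_mul T A B C

/-- The change of coordinates on `gl₃³`: block-diagonal `Φ`. [folklore] -/
def Phi (A B C : Fin 3 → Fin 3 → R) : Matrix Idx Idx R :=
  fun w w' => if w.1 = w'.1 then ![phiBlk A, phiBlk B, phiBlk C] w'.1 w.2 w'.2 else 0

/-- The block scalars `det M_f`. [folklore] -/
def dets (A B C : Fin 3 → Fin 3 → R) : Idx → R :=
  fun w => (![Matrix.of A, Matrix.of B, Matrix.of C] w.1).det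

/-- **Equivariance of the orbit form**: `(A⊗B⊗C)ᵀ · O_T · Φ = O_{(A,B,C)·T} · diag(det)`.
[folklore] -/
theorem kronT_mul_orbitForm_mul (T : Fin 3 → Fin 3 → Fin 3 → R) (A B C : Fin 3 → Fin 3 → R) :
    kronT A B C * orbitForm T * Phi A B C =
      orbitForm (tsubst3 T A B C) * Matrix.diagonal (dets A B C) := by
  ext v w'
  rcases w' with ⟨f, pq⟩
  have key := congrFun (congrFun (kronT_mul_blk_mul T A B C f) v) pq
  simp only [Matrix.mul_apply, Matrix.smul_apply, smul_eq_mul] at key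
  have eR : (orbitForm (tsubst3 T A B C) * Matrix.diagonal (dets A B C)) v (f, pq) =
      (![Matrix.of A, Matrix.of B, Matrix.of C] f).det * blk (tsubst3 T A B C) f v pq := by
    rw [Matrix.mul_diagonal]
    exact mul_comm _ _
  rw [eR, ← key, Matrix.mul_apply, Fintype.sum_prod_type]
  simp only [Phi, mul_ite, mul_zero]
  rw [Finset.sum_comm]
  simp only [Finset.sum_ite_eq', Finset.mem_univ, if_true]
  refine Finset.sum_congr rfl fun pq' _ => ?_
  simp only [Matrix.mul_apply]
  rfl

end Equivariance

/-! ## Rank under substitution and degeneration -/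

section Rank

variable {F : Type*} [Field F]

/-- Invertible substitutions do not increase `rank O`. [folklore] -/
theorem rank_orbitForm_tsubst3_le (T : Fin 3 → Fin 3 → Fin 3 → F) (A B C : Fin 3 → Fin 3 → F)
    (hA : (Matrix.of A).det ≠ 0) (hB : (Matrix.of B).det ≠ 0) (hC : (Matrix.of C).det ≠ 0) :
    (orbitForm (tsubst3 T A B C)).rank ≤ (orbitForm T).rank := by
  have hD : IsUnit (Matrix.diagonal (dets A B C)).det := by
    rw [Matrix.det_diagonal, isUnit_iff_ne_zero]
    refine Finset.prod_ne_zero_iff.2 fun w _ => ?_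
    rcases w with ⟨f, pq⟩
    fin_cases f
    · exact hA
    · exact hB
    · exact hC
  calc (orbitForm (tsubst3 T A B C)).rank
      = (orbitForm (tsubst3 T A B C) * Matrix.diagonal (dets A B C)).rank :=
        (Matrix.rank_mul_eq_left_of_isUnit_det _ _ hD).symm
    _ = (kronT A B C * orbitForm T * Phi A B C).rank := by rw [kronT_mul_orbitForm_mul]
    _ ≤ (kronT A B C * orbitForm T).rank := Matrix.rank_mul_le_left _ _
    _ ≤ (orbitForm T).rank := Matrix.rank_mul_le_right _ _

end Rank

section Degeneration

variable {K : Type u} [Field K]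

/-- **Semicontinuity of `rank O` under degeneration** (same perturbation argument as for `Ω`):
if the integer tensor `S` degenerates to `N` over `K` and `rank O_S ≤ r` over every field receiving
`K`, then `rank O_N ≤ r`. [cite: Alman2021, §2.4] -/
theorem rank_orbitForm_le_of_polyDegeneratesTo (S : Fin 3 → Fin 3 → Fin 3 → ℤ)
    {N : Fin 3 → Fin 3 → Fin 3 → K} (hSN : PolyDegeneratesTo (fun a b c => (S a b c : K)) N)
    {r : ℕ} (hS : ∀ (L : Type u) [Field L], (K →+* L) →
      (orbitForm (fun a b c => (S a b c : L))).rank ≤ r) :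
    (orbitForm N).rank ≤ r := by
  classical
  obtain ⟨h, A, B, C, hABC⟩ := hSN
  obtain ⟨i, -, hA, hB, hC⟩ := exists_pert_det_ne_zero A B C (h + 1)
  set y : K[X] := X ^ (h + 1 + i) with hy
  set s : Fin 3 → Fin 3 → Fin 3 → K := fun a b c => (S a b c : K) with hs
  set T := polySubst s (pert y A) (pert y B) (pert y C) with hT
  have hTc : ∀ a b c, ∀ j ≤ h, (T a b c).coeff j = if j = h then N a b c else 0 := by
    intro a b c j hj
    obtain ⟨q, hq⟩ := polySubst_pert s A B C y a b c
    rw [hT, hq, Polynomial.coeff_add, hy, Polynomial.coeff_X_pow_mul', if_neg (by omega), add_zero]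
    exact hABC a b c j hj
  have hdvd : ∀ a b c, X ^ (h + 1) ∣ T a b c - Polynomial.C (N a b c) * X ^ h := by
    intro a b c
    rw [Polynomial.X_pow_dvd_iff]
    intro d hd
    rw [Polynomial.coeff_sub, Polynomial.coeff_C_mul_X_pow, hTc a b c d (by omega)]
    split_ifs <;> simp
  choose T' hT' using hdvd
  have hTe : T = (X : K[X]) ^ h • ((fun a b c => Polynomial.C (N a b c)) + (X : K[X]) • T') := by
    funext a b c
    simp only [Pi.smul_apply, Pi.add_apply, smul_eq_mul]
    linear_combination hT' a b c
  have hKF : orbitForm T = (X : K[X]) ^ h •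
      ((orbitForm N).map (Polynomial.C : K →+* K[X]) + (X : K[X]) • orbitForm T') := by
    rw [hTe, orbitForm_smul, orbitForm_add, orbitForm_smul, orbitForm_map]
  have hN : ∀ p q, orbitForm T p q =
      (Polynomial.C (orbitForm N p q) + X * orbitForm T' p q) * X ^ h := by
    intro p q
    rw [hKF]
    simp only [Matrix.smul_apply, Matrix.add_apply, Matrix.map_apply, smul_eq_mul]
    ring
  let L := FractionRing K[X]
  have key := rank_le_rank_map_of_perturbation (L := L) (orbitForm N) (orbitForm T')
    (orbitForm T) h hN
  set φ := algebraMap K[X] L with hφ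
  have hinj : Function.Injective φ := IsFractionRing.injective K[X] L
  have hmapT : (fun a b c => φ (T a b c)) = tsubst3 (fun a b c => (S a b c : L))
      (fun x a => φ (pert y A x a)) (fun x a => φ (pert y B x a)) (fun x a => φ (pert y C x a)) := by
    funext a b c
    simp only [hT, polySubst_eq_tsubst3, tsubst3, hs, map_sum, map_mul, map_intCast]
  have hdet' : ∀ {M : Fin 3 → Fin 3 → K[X]}, (Matrix.of M).det ≠ 0 →
      (Matrix.of fun x a => φ (M x a)).det ≠ 0 := by
    intro M hM
    have e : (Matrix.of fun x a => φ (M x a)) = φ.mapMatrix (Matrix.of M) := by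
      ext i j; rfl
    rw [e, ← RingHom.map_det]
    exact (map_ne_zero_iff φ hinj).2 hM
  have hbound : ((orbitForm T).map φ).rank ≤ r := by
    rw [orbitForm_map, hmapT]
    exact (rank_orbitForm_tsubst3_le _ _ _ _ (hdet' hA) (hdet' hB) (hdet' hC)).trans
      (hS L (φ.comp Polynomial.C))
  exact key.trans hbound

end Degeneration

end OrbitRank

end Summit.MatrixMultiplication.MatrixMultiplication.Theorems
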